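import Literature.NumberTheory.Automorphic.UnitaryGroupTorusSiegelSet
import Literature.NumberTheory.Automorphic.UnitaryGroupTorusSiegelIntegral
import HarnessLib

/-!
# The torus Siegel set `S_T ⊆ T(𝔸_F)` of the quasi-split `U(J₂)`: ONE RAY (H-side brick H-B4 of the T1 laws)

Topic `NumberTheory/Automorphic`; namespace `Literature.NumberTheory.Automorphic.UnitaryGroup`.  THEOREMS ONLY (no definition, no
named fact, no instance, no notation, no `sorry`).  The `N = 2` sibling of ★ `UnitaryGroupTorusSiegelSet` (brick H9a) for the H-side
copy of LAWS 1–5 (`H = U(Φ₂) × U(Φ₁)`) of the T1 engine `Cruxes/H413/Lines/F0_T1InnerFormTraceIdentity.lean` (cell `pub/hodgecm-mathlib`,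
crux H413; LEAD WORD #123∕#124 (4) GO, desk deal 2026-08-31T13:50:19Z, census `CENSUS-LAWS-Hside.F0P3a-p03g6.md` §4 H-B4).
HC_CM is proved only modulo the printed citations until rung 0 closes.

Setting: `E/F` quadratic with non-trivial automorphism `c` (`Module.finrank F E = 2`, `c ≠ 1`), `G = U(J₂)(𝔸_F) = (quasiSplit F E c 2).Adelic`,
`B(𝔸_F) = borelAdelic F E c 2`, torus part `torusPart`, diagonal entries `dᵢ = diagUnit · i` (`i : Fin 2`), Borel height `borelHeight`
(★ `UnitaryGroupBorelSemidirect`, ★ `UnitaryGroupBorelHeight`, all typed at general `N`).  The torus of `U(J₂)` is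
`T(𝔸_F) = {diag(d₀, d₁) : c(d₀) d₁ = 1}` — ONE free idele `d₀ ∈ 𝕀_E`, `d₁ = (c d₀)⁻¹`, no anisotropic `U(1)` factor; `T(F)∖T(𝔸_F) = E^×∖𝕀_E`
has ONE non-compact direction, the ray `ρ(ℝ_{>0})`.  Accordingly the Siegel set needs only the split-torus cover
`𝕀_E = W₀ · ι(Eˣ) · ρ(ℝ_{>0})` of ★ `exists_isCompact_normOne_ray_cover` (no ★ `exists_isCompact_adelicOne_cover`).

* §1 TORUS OF `U(J₂)`: `conjAdele_diagUnit_zero_mul_diagUnit_one_two` (`c(d₀) d₁ = 1`), `diagUnit_one_two` (`d₁ = (c • d₀)⁻¹`),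
  `coe_rootValue_two` (the single root value `d₀⁻¹ d₁ = d₀⁻¹ (c • d₀)⁻¹`), **`exists_rational_torus_two`** (the rational torus element
  `diag(k, (c k)⁻¹) ∈ B(𝔸_F) ∩ G(F)` with `d₀ = ι(k)`).
* §2 **`exists_torusSiegelSet_two`** (token-parallel to ★ `exists_torusSiegelSet` minus the second coordinate): a CLOSED set `S_T ⊆ B(𝔸_F)` of
  torus elements and a compact `W ⊆ 𝕀_E` with (EXPORT) `d₀ = w · ρ(e^s)`, `w ∈ W`, `‖d₀‖_𝔸 = e^{[E:ℚ] s}`, `H(t) = ‖d₀‖_𝔸 · H(1)`;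
  (COVER) every torus element is moved into `S_T` by a rational torus element of `B(𝔸_F) ∩ G(F)`; (LETTER) above height `1` the root value
  `d₀⁻¹ d₁` lies in a compact `R ⊆ 𝔸_E`; (BALANCE) on all of `S_T` the archimedean components of `d₀⁻¹ d₁` are `≤ κ · H(t)^{−2/[E:ℚ]}` (the root
  of `U(J₂)` is `ρ(e^{−2s}) · (w c(w))⁻¹`, two powers of the ray — for `U(J₃)`'s `d₀⁻¹ d₁` it was one).

Sequel (FILE B `UnitaryGroupTorusRayTwo`): the diagonal ray `ρ : ℝ → T(𝔸_F)`, coordinate compacta, the «compact · ray» packaging for ★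
`setLIntegral_rpow_neg_borelHeight_lt_top` (any `N`), the height window.

## References
* J. D. Rogawski, *Automorphic Representations of Unitary Groups in Three Variables* (1990), §1.10, §2.2 (p. 13); p. 98 («`G = U(3)`, `U(2)`,
  or `U(2) × U(1)`») [Rogawski1990].
* R. Godement, *Domaines fondamentaux des groupes arithmétiques*, Sém. Bourbaki 257 (1964), §5 [Godement1964].
* J. W. S. Cassels, A. Fröhlich (eds.), *Algebraic Number Theory* (1967), Ch. II §16 [CasselsFrohlichANT1967].
-/

set_option autoImplicit false

noncomputable section

open NumberField IsDedekindDomain Matrix Topology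
open scoped NNReal Pointwise

namespace Literature.NumberTheory.Automorphic

namespace UnitaryGroup

/-! ## §1 The torus of `U(J₂)`: relations, the single root value, rational torus elements -/

section Torus

variable {F E : Type} [Field F] [NumberField F] [Field E] [NumberField E] [Algebra F E] {c : E ≃ₐ[F] E}

/-- **The torus relation of `U(J₂)`: `c(d₀) d₁ = 1`** for a torus element `t` (`torusPart t = t`) with diagonal `d = diagUnit t`
(★ `conjAdele_diagUnit_rev_mul` at `i = 1`, `rev 1 = 0`). [cite: Rogawski1990, §1.10] -/
theorem conjAdele_diagUnit_zero_mul_diagUnit_one_two {t : borelAdelic F E c 2} (ht : torusPart t = t) :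
    conjAdele F E c ((diagUnit t.2 0 : (AdeleRing (𝓞 E) E)ˣ) : AdeleRing (𝓞 E) E) *
      ((diagUnit t.2 1 : (AdeleRing (𝓞 E) E)ˣ) : AdeleRing (𝓞 E) E) = 1 := by
  have h := conjAdele_diagUnit_rev_mul ht 1
  have hrev : Fin.rev (1 : Fin 2) = 0 := by decide
  rwa [hrev] at h

/-- for `U(J₂)`: **`d₁ = (c • d₀)⁻¹`** — the torus has ONE free idele. [cite: Rogawski1990, §1.10] -/
theorem diagUnit_one_two {t : borelAdelic F E c 2} (ht : torusPart t = t) :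
    diagUnit t.2 1 = (c • diagUnit t.2 0)⁻¹ := by
  rw [eq_inv_iff_mul_eq_one]
  refine Units.ext ?_
  rw [Units.val_mul, val_smul_eq_conjAdele, Units.val_one, mul_comm]
  exact conjAdele_diagUnit_zero_mul_diagUnit_one_two ht

/-- **The single root value of `U(J₂)`**: `d₀⁻¹ d₁ = d₀⁻¹ (c • d₀)⁻¹` (`= (d₀ c(d₀))⁻¹ = N_{E/F}(d₀)⁻¹`: the character by which the torus
acts on the root line `N(𝔸_F) ≅ 𝔸_E⁻`). [cite: Rogawski1990, §1.10] -/
theorem coe_rootValue_two {t : borelAdelic F E c 2} (ht : torusPart t = t) :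
    (((diagUnit t.2 0)⁻¹ * diagUnit t.2 1 : (AdeleRing (𝓞 E) E)ˣ) : AdeleRing (𝓞 E) E) =
      (((diagUnit t.2 0)⁻¹ * (c • diagUnit t.2 0)⁻¹ : (AdeleRing (𝓞 E) E)ˣ) : AdeleRing (𝓞 E) E) := by
  rw [diagUnit_one_two ht]

/-- diagonal entries of a product of torus elements multiply (any `N`; cf. ★ `UnitaryGroupTorusSiegelSet`). [cite: Rogawski1990, §1.10] -/
private theorem diagUnit_mul_of_torus₂ {N : ℕ} {t t' : borelAdelic F E c N} (ht : torusPart t = t)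
    (ht' : torusPart t' = t') (i : Fin N) :
    diagUnit (t * t').2 i = diagUnit t.2 i * diagUnit t'.2 i := by
  refine Units.ext ?_
  rw [coe_diagUnit, Units.val_mul, coe_diagUnit, coe_diagUnit]
  change (adelicVal F E c N _ ((t : (quasiSplit F E c N).Adelic) * (t' : (quasiSplit F E c N).Adelic)) :
      Matrix (Fin N) (Fin N) (AdeleRing (𝓞 E) E)) i i = _
  rw [map_mul, Units.val_mul, adelicVal_eq_glDiagonal_diagUnit ht, adelicVal_eq_glDiagonal_diagUnit ht', coe_glDiagonal,
    coe_glDiagonal, Matrix.diagonal_mul_diagonal, Matrix.diagonal_apply_eq, Matrix.diagonal_apply_eq,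
    Matrix.diagonal_apply_eq]

/-- `b ↦ diagUnit b i` is continuous on `B(𝔸_F)` (any `N`; entries of `b` and of `b⁻¹`). [cite: Rogawski1990, §1.10] -/
private theorem continuous_diagUnit₂ {N : ℕ} : Continuous fun b : borelAdelic F E c N => diagUnit b.2 := by
  have hmat : Continuous fun g : (quasiSplit F E c N).Adelic =>
      (adelicVal F E c N _ g : Matrix (Fin N) (Fin N) (AdeleRing (𝓞 E) E)) :=
    Units.continuous_val.comp continuous_subtype_val
  refine continuous_pi fun i => Units.continuous_iff.2 ⟨?_, ?_⟩
  · exact (hmat.comp continuous_subtype_val).matrix_elem i i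
  · change Continuous fun b : borelAdelic F E c N =>
      (adelicVal F E c N _ ((b : (quasiSplit F E c N).Adelic)⁻¹) : Matrix (Fin N) (Fin N) (AdeleRing (𝓞 E) E)) i i
    exact (hmat.comp continuous_subtype_val.inv).matrix_elem i i

/-- **The rational torus element `diag(k, (c k)⁻¹) ∈ T(F)`** (`k ∈ Eˣ`, `c² = 1`) as an element of `B(𝔸_F)` lying in the arithmetic
subgroup, with prescribed first diagonal entry `ι(k)` (the `N = 2` sibling of ★ `exists_rational_torus`). [cite: Rogawski1990, §1.10] -/
theorem exists_rational_torus_two (hcc : ∀ x : E, c (c x) = x) (k : Eˣ) :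
    ∃ τ : borelAdelic F E c 2, (τ : (quasiSplit F E c 2).Adelic) ∈ (quasiSplit F E c 2).arithmeticSubgroup ∧
      torusPart τ = τ ∧ diagUnit τ.2 0 = principalIdele E k := by
  -- the rational diagonal `diag(k, (c k)⁻¹)`
  have hck : c (k : E) ≠ 0 := by rw [Ne, map_eq_zero_iff c c.injective]; exact k.ne_zero
  set kv : Fin 2 → Eˣ := ![k, (Units.mk0 (c (k : E)) hck)⁻¹] with hkv
  have hkv0 : kv 0 = k := rfl
  have hkv1 : kv 1 = (Units.mk0 (c (k : E)) hck)⁻¹ := rfl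
  have hmem : glDiagonal 2 E kv ∈ rational F E c 2 ((StdForm.antidiagonal 2).over E) := by
    refine (glDiagonal_mem_unitaryGroupOfForm_antidiagonal_iff (c : E →+* E) 2 kv).2 fun i => ?_
    fin_cases i
    · show c ((kv (Fin.rev 0) : Eˣ) : E) * ((kv 0 : Eˣ) : E) = 1
      rw [show Fin.rev (0 : Fin 2) = 1 by decide, hkv1, hkv0, Units.val_inv_eq_inv_val, Units.val_mk0, map_inv₀, hcc,
        inv_mul_cancel₀ k.ne_zero]
    · show c ((kv (Fin.rev 1) : Eˣ) : E) * ((kv 1 : Eˣ) : E) = 1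
      rw [show Fin.rev (1 : Fin 2) = 0 by decide, hkv0, hkv1, Units.val_inv_eq_inv_val, Units.val_mk0,
        mul_inv_cancel₀ hck]
  set γ : rational F E c 2 ((StdForm.antidiagonal 2).over E) := ⟨glDiagonal 2 E kv, hmem⟩ with hγ
  set τA : (quasiSplit F E c 2).Adelic := (quasiSplit F E c 2).toAdelic γ with hτA
  -- its adelic matrix is the diagonal of principal ideles
  have hval : adelicVal F E c 2 _ τA = glDiagonal 2 (AdeleRing (𝓞 E) E) (fun i => principalIdele E (kv i)) := by
    refine Units.ext ?_
    change (((toAdelic F E c 2 _ γ : adelic F E c 2 _) : GL (Fin 2) (AdeleRing (𝓞 E) E)) :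
        Matrix (Fin 2) (Fin 2) (AdeleRing (𝓞 E) E)) = _
    rw [coe_toAdelic, coe_glDiagonal]
    change ((glDiagonal 2 E kv : GL (Fin 2) E) : Matrix (Fin 2) (Fin 2) E).map _ = _
    rw [coe_glDiagonal, Matrix.diagonal_map (map_zero _)]
    rfl
  have hτB : τA ∈ borelAdelic F E c 2 := by
    rw [mem_borelAdelic_iff, hval, coe_glDiagonal]
    exact Matrix.blockTriangular_diagonal _
  have hτT : τA ∈ torusAdelic F E c 2 := ⟨_, hval.symm⟩
  refine ⟨⟨τA, hτB⟩, ⟨γ, rfl⟩, torusPart_eq_self_of_mem hτT, ?_⟩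
  refine Units.ext ?_
  rw [coe_diagUnit]
  change (adelicVal F E c 2 _ τA : Matrix (Fin 2) (Fin 2) (AdeleRing (𝓞 E) E)) 0 0 = _
  rw [hval, coe_glDiagonal, Matrix.diagonal_apply_eq, hkv0]

end Torus

/-! ## §2 The torus Siegel set of `U(J₂)` -/

section SiegelSet

variable (F E : Type) [Field F] [NumberField F] [Field E] [NumberField E] [Algebra F E] (c : E ≃ₐ[F] E)

/-- `e^{log u} = u` for a positive unit of `ℝ≥0`. [folklore] -/
private theorem expUnitNNReal_log₂ (u : ℝ≥0ˣ) : expUnitNNReal (Real.log ((u : ℝ≥0) : ℝ)) = u :=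
  Units.ext (NNReal.eq (by
    rw [coe_expUnitNNReal]
    exact Real.exp_log (NNReal.coe_pos.2 (pos_iff_ne_zero.2 u.ne_zero))))

/-- **THE TORUS SIEGEL SET of `U(J₂)` (H-side brick H-B4): ONE RAY.**  For `E/F` quadratic with non-trivial automorphism `c`: there are a
CLOSED set `S_T ⊆ B(𝔸_F)` of torus elements and a compact `W ⊆ 𝕀_E` such that (EXPORT) every `t ∈ S_T` has first diagonal entry
`d₀ = w · ρ(e^s)` on the ray through `W`, `‖d₀‖_𝔸 = e^{[E:ℚ] s}` and height `H(t) = ‖d₀‖_𝔸 · H(1)`; (COVER) every torus element is moved into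
`S_T` by a rational torus element of `B(𝔸_F) ∩ G(F)`; (LETTER) above height `1` the root value `d₀⁻¹ d₁` lies in a compact `R ⊆ 𝔸_E`; (BALANCE) on
all of `S_T` the archimedean components of `d₀⁻¹ d₁` are `≤ κ · H(t)^{−2/[E:ℚ]}`.  Reduction theory of the rank-one torus
`T(F)∖T(𝔸_F) = E^×∖𝕀_E = (E^×∖𝕀_E¹) × ℝ_{>0}` (Rogawski §2.2 for `U(2)`; Godement §5). [cite: Rogawski1990, §2.2 (p. 13)] [cite: Godement1964, §5 Thm. 4] -/
theorem exists_torusSiegelSet_two (h2 : Module.finrank F E = 2) (hc1 : c ≠ 1) :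
    ∃ (S_T : Set (borelAdelic F E c 2)) (W : Set (AdeleRing (𝓞 E) E)ˣ),
      IsClosed S_T ∧ IsCompact W ∧
      (∀ t ∈ S_T, torusPart t = t) ∧
      (∀ t ∈ S_T, ∃ w ∈ W, ∃ s : ℝ,
          diagUnit t.2 0 = w * posRealIdele E (expUnitNNReal s) ∧
          IdeleClassGroup.ideleNorm E (diagUnit t.2 0) = ((expUnitNNReal (Module.finrank ℚ E * s) : ℝ≥0ˣ) : ℝ≥0) ∧
          borelHeight (t : (quasiSplit F E c 2).Adelic) =
            IdeleClassGroup.ideleNorm E (diagUnit t.2 0) * borelHeight (1 : (quasiSplit F E c 2).Adelic)) ∧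
      (∀ t : borelAdelic F E c 2, torusPart t = t →
        ∃ τ : borelAdelic F E c 2, (τ : (quasiSplit F E c 2).Adelic) ∈ (quasiSplit F E c 2).arithmeticSubgroup ∧
          torusPart τ = τ ∧ τ * t ∈ S_T) ∧
      (∃ R : Set (AdeleRing (𝓞 E) E), IsCompact R ∧ ∀ t ∈ S_T,
          1 ≤ borelHeight (t : (quasiSplit F E c 2).Adelic) →
          (((diagUnit t.2 0)⁻¹ * diagUnit t.2 1 : (AdeleRing (𝓞 E) E)ˣ) : AdeleRing (𝓞 E) E) ∈ R) ∧
      (∃ κ : ℝ, ∀ t ∈ S_T, ∀ w : InfinitePlace E,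
          ‖((((diagUnit t.2 0)⁻¹ * diagUnit t.2 1 : (AdeleRing (𝓞 E) E)ˣ) : AdeleRing (𝓞 E) E)).1 w‖ ≤
            κ * ((borelHeight (t : (quasiSplit F E c 2).Adelic) : ℝ) ^ (-(2 / (Module.finrank ℚ E : ℝ))))) := by
  classical
  haveI : FiniteDimensional F E := Module.finite_of_finrank_eq_succ h2
  -- `c² = 1`
  have hcc : ∀ x : E, c (c x) = x := by
    intro x
    rcases algEquiv_eq_one_or_eq F E c h2 hc1 (c * c) with h | h
    · exact congrArg (fun f : E ≃ₐ[F] E => f x) h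
    · exact absurd (mul_left_cancel (a := c) (h.trans (mul_one c).symm)) hc1
  -- the split-torus cover
  obtain ⟨W₀, hW₀c, hW₀1, hcov₀⟩ := exists_isCompact_normOne_ray_cover E
  -- the set
  set ST : Set (borelAdelic F E c 2) := {t | torusPart t = t ∧
    diagUnit t.2 0 ∈ W₀ * (posRealIdeles E : Set (AdeleRing (𝓞 E) E)ˣ)} with hST
  -- constants: `n = [E:ℚ]`, `H₁ = H(1) > 0`
  set n : ℕ := Module.finrank ℚ E with hn
  have hn0 : n ≠ 0 := Module.finrank_pos.ne'
  set H₁ : ℝ≥0 := borelHeight (1 : (quasiSplit F E c 2).Adelic) with hH₁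
  have hH₁0 : 0 < H₁ := borelHeight_pos (1 : (quasiSplit F E c 2).Adelic)
  -- EXPORT data of an element of `ST`
  have hexp : ∀ t ∈ ST, ∃ w ∈ W₀, ∃ u : ℝ≥0ˣ, diagUnit t.2 0 = w * posRealIdele E u ∧
      IdeleClassGroup.ideleNorm E (diagUnit t.2 0) = (u : ℝ≥0) ^ n ∧
      borelHeight (t : (quasiSplit F E c 2).Adelic) = (u : ℝ≥0) ^ n * H₁ := by
    rintro t ⟨ht, ⟨w, hw, p, ⟨u, rfl⟩, hwp⟩⟩
    have hd0 : diagUnit t.2 0 = w * posRealIdele E u := hwp.symm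
    have hnorm : IdeleClassGroup.ideleNorm E (diagUnit t.2 0) = (u : ℝ≥0) ^ n := by
      rw [hd0, map_mul, hW₀1 w hw, one_mul, ideleNorm_posRealIdele_holds E u]
    refine ⟨w, hw, u, hd0, hnorm, ?_⟩
    have h := borelHeight_torus_mul' (adelicVal_eq_glDiagonal_diagUnit ht).symm (1 : (quasiSplit F E c 2).Adelic)
    rw [mul_one] at h
    rw [h, hnorm]
  refine ⟨ST, W₀, ?_, hW₀c, fun t ht => ht.1, ?_, ?_, ?_, ?_⟩
  · -- closed
    haveI := t2Space_borelAdelic (F := F) (E := E) (c := c) (N := 2)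
    haveI := t2Space_ideleGroup E
    have hA : IsClosed {t : borelAdelic F E c 2 | torusPart t = t} := isClosed_eq continuous_torusPart continuous_id
    have hB : IsClosed {t : borelAdelic F E c 2 | diagUnit t.2 0 ∈ W₀ * (posRealIdeles E : Set (AdeleRing (𝓞 E) E)ˣ)} :=
      ((isClosed_posRealIdeles E).mul_left_of_isCompact hW₀c).preimage
        ((continuous_apply 0).comp (continuous_diagUnit₂ (F := F) (E := E) (c := c)))
    rw [hST, Set.setOf_and]
    exact hA.inter hB
  · -- EXPORT
    intro t ht
    obtain ⟨w, hw, u, hd0, hnorm, hH⟩ := hexp t ht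
    refine ⟨w, hw, Real.log ((u : ℝ≥0) : ℝ), ?_, ?_, ?_⟩
    · rw [expUnitNNReal_log₂]; exact hd0
    · rw [hnorm]
      apply NNReal.eq
      rw [NNReal.coe_pow, coe_expUnitNNReal, Real.exp_nat_mul,
        Real.exp_log (NNReal.coe_pos.2 (pos_iff_ne_zero.2 u.ne_zero))]
    · rw [hH, hnorm]
  · -- COVER
    intro t ht
    obtain ⟨w, hw, k, s, hk⟩ := hcov₀ (diagUnit t.2 0)
    obtain ⟨τ, hτrat, hτ, hτ0⟩ := exists_rational_torus_two (F := F) hcc k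
    refine ⟨τ, hτrat, hτ, ?_, ?_⟩
    · rw [torusPart_mul, hτ, ht]
    · rw [diagUnit_mul_of_torus₂ hτ ht 0, hτ0, mul_comm (principalIdele E k), hk]
      exact Set.mul_mem_mul hw (posRealIdele_mem_posRealIdeles E _)
  · -- LETTER: the root value above height `1`
    -- threshold: `1 ≤ H(t) = u^n H₁` forces `u⁻¹ ≤ M := H₁^{1/n}` (as reals)
    set M : ℝ := ((H₁ : ℝ≥0) : ℝ) ^ (1 / (n : ℝ)) with hM
    refine ⟨(fun p : AdeleRing (𝓞 E) E × AdeleRing (𝓞 E) E => p.1 * p.2) ''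
        ((((↑) : (AdeleRing (𝓞 E) E)ˣ → AdeleRing (𝓞 E) E) '' ((fun w => w⁻¹ * (c • w)⁻¹) '' W₀)) ×ˢ
          {a : AdeleRing (𝓞 E) E | (∀ v : HeightOneSpectrum (𝓞 E), a.2 v ∈ v.adicCompletionIntegers E) ∧
            ∀ w : InfinitePlace E, ‖a.1 w‖ ≤ M * M}),
      isCompact_coe_mul_integralBox E
        (hW₀c.image ((continuous_inv.mul (continuous_galSmul_idele F E c).inv))) (M * M),
      fun t ht hH1 => ?_⟩
    obtain ⟨w, hw, u, hd0, hnorm, hH⟩ := hexp t ht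
    -- `u⁻¹ ≤ M`
    have hu0 : (0 : ℝ) < ((u : ℝ≥0) : ℝ) := NNReal.coe_pos.2 (pos_iff_ne_zero.2 u.ne_zero)
    have huM : (((u⁻¹ : ℝ≥0ˣ) : ℝ≥0) : ℝ) ≤ M := by
      rw [Units.val_inv_eq_inv_val, NNReal.coe_inv, hM]
      have h1' : (1 : ℝ) ≤ ((u : ℝ≥0) : ℝ) ^ n * ((H₁ : ℝ≥0) : ℝ) := by
        have := hH1; rw [hH] at this; exact_mod_cast this
      have hH₁r : (0 : ℝ) < ((H₁ : ℝ≥0) : ℝ) := NNReal.coe_pos.2 hH₁0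
      have hun : (((u : ℝ≥0) : ℝ) ^ n)⁻¹ ≤ ((H₁ : ℝ≥0) : ℝ) := by
        rw [inv_le_iff_one_le_mul₀ (pow_pos hu0 n)]
        linarith [mul_comm (((u : ℝ≥0) : ℝ) ^ n) ((H₁ : ℝ≥0) : ℝ)]
      have : (((u : ℝ≥0) : ℝ)⁻¹) = ((((u : ℝ≥0) : ℝ) ^ n)⁻¹) ^ (1 / (n : ℝ)) := by
        rw [← Real.rpow_natCast, ← Real.inv_rpow hu0.le, ← Real.rpow_mul (inv_nonneg.2 hu0.le),
          mul_one_div_cancel (Nat.cast_ne_zero.2 hn0), Real.rpow_one]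
      rw [this]
      exact Real.rpow_le_rpow (inv_nonneg.2 (pow_nonneg hu0.le n)) hun (by positivity)
    have huMM : (((u⁻¹ * u⁻¹ : ℝ≥0ˣ) : ℝ≥0) : ℝ) ≤ M * M := by
      have hu' : (0 : ℝ) ≤ (((u⁻¹ : ℝ≥0ˣ) : ℝ≥0) : ℝ) := NNReal.coe_nonneg _
      rw [Units.val_mul, NNReal.coe_mul]
      exact mul_le_mul huM huM hu' (hu'.trans huM)
    rw [diagUnit_one_two ht.1, coe_rootValue₂_eq F E c hd0, Set.image_mul_prod]
    exact Set.mul_mem_mul ⟨w⁻¹ * (c • w)⁻¹, ⟨w, hw, rfl⟩, rfl⟩ (coe_posRealIdele_mem_integralBox E huMM)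
  · -- BALANCE
    obtain ⟨C, hC0, hC⟩ := exists_forall_norm_fst_apply_le E (hW₀c.image ((continuous_inv.mul (continuous_galSmul_idele F E c).inv)))
    refine ⟨C * (((H₁ : ℝ≥0) : ℝ) ^ (1 / (n : ℝ))) ^ 2, fun t ht w' => ?_⟩
    obtain ⟨w, hw, u, hd0, hnorm, hH⟩ := hexp t ht
    have hu0 : (0 : ℝ) < ((u : ℝ≥0) : ℝ) := NNReal.coe_pos.2 (pos_iff_ne_zero.2 u.ne_zero)
    have hH₁r : (0 : ℝ) < ((H₁ : ℝ≥0) : ℝ) := NNReal.coe_pos.2 hH₁0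
    -- `H(t)^{-1/n} = u⁻¹ · H₁^{-1/n}` and `H(t)^{-2/n} = (H(t)^{-1/n})²`
    have hpow : ((borelHeight (t : (quasiSplit F E c 2).Adelic) : ℝ≥0) : ℝ) ^ (-(1 / (n : ℝ))) =
        ((u : ℝ≥0) : ℝ)⁻¹ * (((H₁ : ℝ≥0) : ℝ) ^ (1 / (n : ℝ)))⁻¹ := by
      rw [hH, NNReal.coe_mul, NNReal.coe_pow, Real.mul_rpow (pow_nonneg hu0.le n) hH₁r.le,
        Real.rpow_neg hH₁r.le, Real.rpow_neg (pow_nonneg hu0.le n), ← Real.rpow_natCast,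
        ← Real.rpow_mul hu0.le, mul_one_div_cancel (Nat.cast_ne_zero.2 hn0), Real.rpow_one]
    have hpow2 : ((borelHeight (t : (quasiSplit F E c 2).Adelic) : ℝ≥0) : ℝ) ^ (-(2 / (n : ℝ))) =
        (((u : ℝ≥0) : ℝ)⁻¹ * (((H₁ : ℝ≥0) : ℝ) ^ (1 / (n : ℝ)))⁻¹) ^ 2 := by
      rw [← hpow, show (-(2 / (n : ℝ))) = (-(1 / (n : ℝ))) * 2 by ring,
        Real.rpow_mul (NNReal.coe_nonneg _), Real.rpow_two]
    have hfst : ∀ x y : AdeleRing (𝓞 E) E, (x * y).1 w' = x.1 w' * y.1 w' := fun _ _ => rfl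
    rw [diagUnit_one_two ht.1, coe_rootValue₂_eq F E c hd0, hfst, norm_mul, hpow2]
    have hρ : ‖((posRealIdele E (u⁻¹ * u⁻¹) : (AdeleRing (𝓞 E) E)ˣ) : AdeleRing (𝓞 E) E).1 w'‖ =
        ((u : ℝ≥0) : ℝ)⁻¹ * ((u : ℝ≥0) : ℝ)⁻¹ := by
      rw [← coe_nnnorm, nnnorm_posRealIdele_fst_apply, Units.val_mul, Units.val_inv_eq_inv_val, NNReal.coe_mul, NNReal.coe_inv]
    rw [hρ]
    have hb := hC (w⁻¹ * (c • w)⁻¹) ⟨w, hw, rfl⟩ w'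
    have hM0 : (0 : ℝ) < ((H₁ : ℝ≥0) : ℝ) ^ (1 / (n : ℝ)) := Real.rpow_pos_of_pos hH₁r _
    calc ‖((w⁻¹ * (c • w)⁻¹ : (AdeleRing (𝓞 E) E)ˣ) : AdeleRing (𝓞 E) E).1 w'‖ * (((u : ℝ≥0) : ℝ)⁻¹ * ((u : ℝ≥0) : ℝ)⁻¹)
        ≤ C * (((u : ℝ≥0) : ℝ)⁻¹ * ((u : ℝ≥0) : ℝ)⁻¹) :=
          mul_le_mul_of_nonneg_right hb (mul_nonneg (inv_nonneg.2 hu0.le) (inv_nonneg.2 hu0.le))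
      _ = C * (((H₁ : ℝ≥0) : ℝ) ^ (1 / (n : ℝ))) ^ 2 *
            (((u : ℝ≥0) : ℝ)⁻¹ * (((H₁ : ℝ≥0) : ℝ) ^ (1 / (n : ℝ)))⁻¹) ^ 2 := by
          field_simp

end SiegelSet

end UnitaryGroup

end Literature.NumberTheory.Automorphic

end
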